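import Literature.NumberTheory.Automorphic.BookerStrongArtinAdditiveTwistProofs
import Literature.NumberTheory.Automorphic.ArtinLFunctionsRankOneMatching
import HarnessLib

/-!
# Booker 2003, Lemma 1: the named fact `booker_additiveTwist_meromorphic` holds

Topic `Literature/NumberTheory/Automorphic`; namespace `Literature.NumberTheory.Automorphic`.  Discharge
(D-0014/D-0026) of the named fact `booker_additiveTwist_meromorphic` of `BookerStrongArtin.lean`:

> **Booker, *Poles of Artin L-functions and the strong Artin conjecture*, Ann. of Math. 158 (2003),
> Lemma 1 (p. 1092).** "Let `α` be a rational number.  Then `L(s,ρ,α)` has meromorphic continuation to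
> the complex plane, with poles possible only in the strip `0 < Re(s) < 1`, and is expressible as the
> ratio of two entire functions of order 1."

(the tree's fact records the continuation and the location of the poles, for irreducible even
`ρ : Γ_ℚ → GL₂(ℂ)`).  Booker's proof is assembled in `BookerStrongArtinAdditiveTwistProofs`
(`Booker2003.booker_additiveTwist_meromorphic_of_artin_functional_equation`): the algebraic half — the
additive twist is a finite combination `∑ᵢ cᵢ qᵢ^{-s} L(s, ρ ⊗ χᵢ)`-type series, Booker (6)–(8), with the
Euler factors at `p` handled as polynomials in `p^{-s}` — and the analytic half — each `L(s, ρ ⊗ χ₀)` "is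
holomorphic in `Re(s) ≥ 1`" (Heilbronn; `ArtinLFunctionRegularReGeOneProofs`) "and by the functional
equation, in `Re(s) ≤ 0`" (p. 1091; `ArtinLFunctionOffStripProofs`).  The one input that was a named fact,
Artin's functional equation over `ℚ` (Neukirch VII (12.6)), is now the tree theorem
`artin_functional_equation_holds` (`ArtinLFunctionsRankOneMatching`: Brauer's factorisation of the
completed L-function, Artin reciprocity in degree one, Hecke's functional equation VII (8.6), and the
analytic matching of conductors and `Γ`-factors), so the fact holds outright.

## References

* A. R. Booker, *Poles of Artin L-functions and the strong Artin conjecture*, Ann. of Math. (2) 158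
  (2003), 1089–1098, Lemma 1 and its proof, pp. 1091–1093. [Booker2003]
* J. Neukirch, *Algebraic Number Theory*, Springer 1999, Ch. VII §12 Thm. (12.6). [NeukirchANT1999]
-/

noncomputable section

namespace Literature.NumberTheory.Automorphic

/-- **Booker 2003, Lemma 1 — the named fact `booker_additiveTwist_meromorphic` holds**: for every
irreducible even `σ : Γ_ℚ → GL₂(ℂ)` with Dirichlet coefficients `a` (`LSeries a = L(s, σ)` on
`Re s > 1`) and every rational `α`, the additive twist `∑ aₙ e(nα) n^{-s}` agrees on `Re s > 1` with a
function meromorphic on `ℂ` and analytic at every `s` with `Re s ≤ 0` or `Re s ≥ 1`.  Proof: Booker's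
(`Booker2003.booker_additiveTwist_meromorphic_of_artin_functional_equation`), with Artin's functional
equation over `ℚ` supplied by the theorem `artin_functional_equation_holds`.
[cite: Booker2003, Lemma 1 (p. 1092) and its proof (pp. 1091–1093)] -/
theorem booker_additiveTwist_meromorphic_holds : booker_additiveTwist_meromorphic :=
  Booker2003.booker_additiveTwist_meromorphic_of_artin_functional_equation artin_functional_equation_holds

end Literature.NumberTheory.Automorphic

end
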